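import Summits.ABC.ABC.Theses.RibetTakahashiSplit
import Summits.ABC.ABC.Theorems.RibetTakahashiSplitValuationProductOfCurvesModels
import HarnessLib

/-!
# Route RibetTakahashiSplit — glue B `ValuationProductOfCurves` (stmt-ABC-1571)

`Summit.ABC.ABC.Theses.RibetTakahashiSplit.ValuationProductOfCurves` is
`ManyPrimeValuationProduct → FewPrimeValuationProduct → AbcValuationProduct`: the valuation-product
bounds `T(E) := ∏_{p ∥ N_E} v_p(Δ_min(E)) ≤ C_ε N_E^ε` for elliptic curves `E/ℚ` semistable away
from `2`, in the two regimes "`≥ 4` odd multiplicative primes" (r2) and "`≤ 3` odd multiplicative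
primes" (r4), imply `∏_{p ∣ abc} v_p(abc) ≤ K_ε rad(abc)^ε` for every abc triple `a + b = c`.
This file proves it (`valuationProductOfCurves_proof`), unconditionally and with no named fact.

## Proof (Frey translation, Bombieri–Gubler Example 12.5.10)

For an abc triple take the Frey–Hellegouarch curve `y² = x(x − A)(x + B)` in a global minimal
integral model `W₀` from `Literature.NumberTheory.EllipticCurves.SzpiroFreyProofs`:

* if `16 ∣ abc`: Serre's arrangement `(A, B)` of `{±a, ±b, ±c}` (`exists_arrangement`:
  `A ≡ −1 (mod 4)`, `16 ∣ B`, `|AB(A+B)| = abc`) and the model (12.18) `freyIntModel₂ A B`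
  (`isMinimalAt_freyIntModel₂`; `N ∣ rad(abc)`, `conductorNorm_freyIntModel₂_dvd`;
  `Δ = (AB/16)²(A+B)²`);
* otherwise the model (12.17) `freyIntModel a b` (`isMinimalAt_freyIntModel`; `N ∣ 2¹⁰ rad(abc)`,
  `conductorNorm_freyIntModel_dvd`; `Δ = 16 (abc)²`).

In both cases (`ValuationProductOfCurves.freyIntModel₂_package`,
`ValuationProductOfCurves.freyIntModel_package`, helper file
`RibetTakahashiSplitValuationProductOfCurvesModels`): the curve is semistable away from `2`; every odd
`p ∣ abc` is a multiplicative prime (`p ∣ Δ`, `p ∤ c₄`, B–G 12.5.9(b)) with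
`v_p(Δ_min) = 2 v_p(abc) ≥ v_p(abc)` (`|Δ_min| = |Δ(W₀)|`, `minimalDiscriminantNorm_eq_natAbs_holds`);
every multiplicative prime has `v_p(Δ_min) ≥ 1` (B–G 12.5.9(a),(d)); and at `p = 2` either
`v₂(abc) ≤ 4` or (`32 ∣ abc`, model (12.18)) `2` is multiplicative with
`v₂(Δ_min) = 2 v₂(abc) − 8 ≥ v₂(abc)/4`. The elementary
`ValuationProductOfCurves.prod_factorization_le_four_mul` turns these three facts into
`∏_{p ∣ abc} v_p(abc) ≤ 4 · T(W₀ ⊗ ℚ)` (`ValuationProductOfCurves.exists_curve`). Finally r2 or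
r4 — according to the number of odd multiplicative primes, an exhaustive case split — gives
`T ≤ max(C₂, C₄, 0) · N^ε ≤ max(C₂, C₄, 0) · 2^{10ε} rad(abc)^ε`, so
`K_ε = 4 max(C₂, C₄, 0) 2^{10ε}`.

The intermediate results are stated for reuse by the sibling glue A
(`SubexpManyPrimesOfValuationProduct`, stmt-ABC-1570), which runs the same translation.

## References

* E. Bombieri, W. Gubler, *Heights in Diophantine Geometry*, New Math. Monogr. 4, CUP 2006,
  12.5.9, Example 12.5.10, Theorem 12.5.12. [BombieriGubler2006]
* H. Pasten, *Shimura curves and the abc conjecture*, J. Number Theory 254 (2024), Thms 1.10–1.12,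
  §16 (the products `∏_{p ∣ N^*} v_p(Δ_E)` and `d(abc)`). [PastenShimura2024]
-/

-- `Summit.<Summit>.<Problem>` is the mandated summit-side namespace (CONVENTIONS §2); for the
-- single-conjunct summit `ABC` the two coincide, so the duplicate `ABC.ABC` is deliberate.
set_option linter.dupNamespace false

noncomputable section

namespace Summit.ABC.ABC.Theorems

open IsDedekindDomain WeierstrassCurve UniqueFactorizationMonoid Rat.HeightOneSpectrum
open Literature.NumberTheory.EllipticCurves Literature.NumberTheory.DiophantineGeometry

/-! ## Frey translation for an abc triple, and the glue -/

/-- **Frey translation.** Every abc triple `(a, b, c)` carries an elliptic curve `W/ℚ`, semistable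
away from `2`, whose conductor is divisible by every odd prime of `abc` (they are multiplicative
primes) and divides `2¹⁰ rad(abc)`, with `∏_{p ∣ abc} v_p(abc) ≤ 4 · T(W)`,
`T(W) = ∏_{p ∥ N_W} v_p(Δ_min(W))` (`multiplicativeValuationProduct`): the Frey curve in the model
(12.18) of Serre's arrangement if `16 ∣ abc`, in the model (12.17) otherwise.
[cite: BombieriGubler2006, Ex. 12.5.10] -/
theorem ValuationProductOfCurves.exists_curve {a b c : ℕ} (h : IsABCTriple a b c) :
    ∃ W : WeierstrassCurve ℚ, W.IsElliptic ∧
      (∀ p : ℕ, p.Prime → p ≠ 2 → ¬ p ^ 2 ∣ W.conductorNorm ℤ) ∧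
      (∀ p ∈ (a * b * c).primeFactors, p ≠ 2 → p ∣ W.conductorNorm ℤ) ∧
      W.conductorNorm ℤ ∣ 2 ^ 10 * rad a b c ∧
      ∏ p ∈ (a * b * c).primeFactors, (a * b * c).factorization p ≤
        4 * multiplicativeValuationProduct W := by
  have h' := h
  obtain ⟨ha, hb, habc, hcop⟩ := h'
  have hc : 0 < c := by omega
  have habc0 : a * b * c ≠ 0 := by positivity
  by_cases h16 : 16 ∣ a * b * c
  · obtain ⟨A, B, hAB, hA, hB, hprod, -⟩ := exists_arrangement h h16
    have h0 : A * B * (A + B) ≠ 0 := by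
      rw [← Int.natAbs_ne_zero, hprod]; exact habc0
    obtain ⟨hE, hss, hdvd, hN, hle⟩ := ValuationProductOfCurves.freyIntModel₂_package hAB h0 hA hB
    rw [hprod] at hdvd hle
    refine ⟨(freyIntModel₂ A B).baseChange ℚ, hE, fun p hp _ => hss p hp, hdvd, ?_, hle⟩
    rw [rad_def, ← hprod]
    exact hN.trans (dvd_mul_left _ _)
  · have hab : IsCoprime (a : ℤ) (b : ℤ) := Nat.isCoprime_iff_coprime.mpr hcop
    have hP : (a : ℤ) * b * (a + b) = ((a * b * c : ℕ) : ℤ) := by rw [← habc]; push_cast; ring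
    have h0 : (a : ℤ) * b * (a + b) ≠ 0 := by rw [hP]; exact_mod_cast habc0
    have h16' : ¬ (16 : ℤ) ∣ (a : ℤ) * b * (a + b) := by
      rw [hP]; exact_mod_cast mt Int.natCast_dvd_natCast.mp h16
    obtain ⟨hE, hss, hdvd, hN, hle⟩ := ValuationProductOfCurves.freyIntModel_package hab h0 h16'
    rw [hP, Int.natAbs_natCast] at hdvd hN hle
    exact ⟨(freyIntModel (a : ℤ) b).baseChange ℚ, hE, hss, hdvd, by rwa [rad_def], hle⟩

/-- **Glue B of route `RibetTakahashiSplit` (item stmt-ABC-1571).** The many-prime (`r2`,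
`ManyPrimeValuationProduct`) and few-prime (`r4`, `FewPrimeValuationProduct`) valuation-product
bounds `T(E) ≤ C_ε N_E^ε` for elliptic curves semistable away from `2` together give Pasten's
`d(abc)`-statement with exponent `ε` (`AbcValuationProduct`):
`∏_{p ∣ abc} v_p(abc) ≤ K_ε rad(abc)^ε` for every abc triple. Proof: the Frey translation
`ValuationProductOfCurves.exists_curve` (`∏ v_p(abc) ≤ 4 T(E_{a,b,c})`, `N ∣ 2¹⁰ rad`), the case
split on the number of odd multiplicative primes being exhaustive; `K = 4 max(C₂, C₄, 0) 2^{10ε}`.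
[folklore] -/
theorem valuationProductOfCurves_proof :
    Summit.ABC.ABC.Theses.RibetTakahashiSplit.ValuationProductOfCurves := by
  intro hR2 hR4 ε hε
  obtain ⟨C₂, hC₂⟩ := hR2 ε hε
  obtain ⟨C₄, hC₄⟩ := hR4 ε hε
  set C : ℝ := max (max C₂ C₄) 0 with hCdef
  have hC0 : 0 ≤ C := le_max_right _ _
  refine ⟨4 * C * ((2 : ℝ) ^ 10) ^ ε, fun a b c h => ?_⟩
  -- the two cruxes cover every curve semistable away from `2`
  have hT : ∀ (W : WeierstrassCurve ℚ) [W.IsElliptic],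
      (∀ p : ℕ, p.Prime → p ≠ 2 → ¬ p ^ 2 ∣ W.conductorNorm ℤ) →
      (multiplicativeValuationProduct W : ℝ) ≤ C * (W.conductorNorm ℤ : ℝ) ^ ε := by
    intro W _ hss
    have hNε : 0 ≤ (W.conductorNorm ℤ : ℝ) ^ ε := by positivity
    rcases le_or_gt 4 ((W.conductorNorm ℤ).primeFactors.filter
        (fun p => p ≠ 2 ∧ ¬ p ^ 2 ∣ W.conductorNorm ℤ)).card with h4 | h3
    · exact (hC₂ W hss h4).trans (mul_le_mul_of_nonneg_right
        ((le_max_left _ _).trans (le_max_left _ _)) hNε)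
    · exact (hC₄ W hss (by omega)).trans (mul_le_mul_of_nonneg_right
        ((le_max_right _ _).trans (le_max_left _ _)) hNε)
  obtain ⟨W, hE, hss, -, hN, hprod⟩ := ValuationProductOfCurves.exists_curve h
  haveI := hE
  set N : ℝ := ((W.conductorNorm ℤ : ℕ) : ℝ) with hNdef
  set R : ℝ := ((rad a b c : ℕ) : ℝ) with hRdef
  have hR0 : 0 < R := by
    rw [hRdef, rad_def]; exact_mod_cast Nat.radical_pos _
  have hNR : N ≤ 2 ^ 10 * R := by
    have := Nat.le_of_dvd (mul_pos (by positivity) (by rw [rad_def]; exact Nat.radical_pos _)) hN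
    rw [hNdef, hRdef]; exact_mod_cast this
  have key := hT W hss
  calc ((∏ p ∈ (a * b * c).primeFactors, (a * b * c).factorization p : ℕ) : ℝ)
      ≤ ((4 * multiplicativeValuationProduct W : ℕ) : ℝ) := by exact_mod_cast hprod
    _ = 4 * (multiplicativeValuationProduct W : ℝ) := by push_cast; ring
    _ ≤ 4 * (C * N ^ ε) := by gcongr
    _ ≤ 4 * (C * (2 ^ 10 * R) ^ ε) := by gcongr
    _ = 4 * C * ((2 : ℝ) ^ 10) ^ ε * R ^ ε := by
        rw [Real.mul_rpow (by positivity) hR0.le]; ring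

end Summit.ABC.ABC.Theorems

end
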